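import Mathlib
import HarnessLib
import Summits.NavierStokesRegularity.NavierStokesRegularity.Theorems.CompletionRelayChainRelayFrontStepBootstrap

/-!
# `CompletionRelayChain` — crux `RelayFrontStep` (item stmt-NavierStokesRegularity-24850), LINE `window_v2`,
  registered stub `stub_ignition` (Phase II of the hybrid, CERT-SPEC §8): THE IGNITION CLOCK, one piece

Generic real-analysis core of the ignition lemma (blueprint `IGNITION-BLUEPRINT-crc-p2.md` §3, evidence on the
item). During the ignition stretch the next trigger `u₁` grows at least like `u₁′ ≥ Λ₁ m u₁` where `m` is a lower
bound of `x₁ − x₂`; using `v = u₁²` as a clock turns time integrals of `Λ₁u₁²` into increments of `v`: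
`∫ Λ₁u₁² dt ≤ (v(t) − v(t_a))/(2m)`. On ONE piece `[t_a, t_b]` on which the trigger stays in a window
`w_a ≤ u₁ ≤ w_b`, this file proves, for plain real functions with one-sided derivative bounds
(`derivWithin` on `Icc 0 τ`, as `TaoCascade.PseudoFlowOn` provides them):
* `clock_integral_le` — `∫_{t_a}^{t} Λ₁u₁² ≤ (u₁(t)² − u₁(t_a)²)/(2m′)` whenever `u₁′ ≥ Λ₁ m′ u₁ > 0` on `[t_a,t]`;
* `clock_time_le` — the elapsed time `t − t_a ≤ log(u₁(t)/u₁(t_a))/(Λ₁m′)`;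
* `clock_piece_x2` — the within-piece bootstrap: if `x₂(t_a) ≤ X_a`, `x₁ + x₂ ≥ s` on the piece,
  `x₂′ ≤ Λ₁u₁² + ε`, `u₁′ ≥ Λ₁(x₁ − x₂)u₁ − ε₁`, and the numeric room condition
  `X_a + (w_b² − w_a²)/(2m′) + ε(t_b − t_a) < X_b` with `m′ ≤ s − 2X_b` (and `ε₁ ≤ Λ₁(s − 2X_b − m′)w_a`) holds,
  then `x₂ ≤ X_b` on the whole piece (hence `x₁ − x₂ ≥ s − 2X_b ≥ m′` there).
These are the recurrences `X₂(j+1) = X₂(j) + Δv/(2m_j)`, `Δs_j ≤ log(w_{j+1}²/w_j²)/(2Λ₁m_j)` of the blueprint; the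
relay/`u₂` recurrences and the assembly over the `N` pieces are separate files.

No definitions. HONEST FRAMING: elementary calculus (MODEL-lattice bookkeeping, Tao 2016 §4 vocabulary only in the
docstrings); helper for the crux, no stub credit; nothing here is a statement about the Navier–Stokes equations.
-/

noncomputable section

-- the summit-side namespace `Summit.NavierStokesRegularity.NavierStokesRegularity.…` (single-conjunct summit,
-- D-0017) repeats a component by design; the dupNamespace linter would flag every declaration.
set_option linter.dupNamespace false

open Set MeasureTheory intervalIntegral

namespace Summit.NavierStokesRegularity.NavierStokesRegularity.Cruxes.RelayFrontStep.Window2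

/-! ### FTC-type inequalities for functions that are `C¹` on `Icc 0 τ` -/

/-- Increment of a `C¹` function on a sub-interval `[a, b] ⊆ [0, τ]` from an upper bound on its one-sided
derivative: if `derivWithin f (Icc 0 τ) ≤ g` on `[a, b]` with `g` continuous on `[a,b]`, then
`f b − f a ≤ ∫_a^b g`. [folklore] -/
theorem increment_le_integral_of_derivWithin_le {f g : ℝ → ℝ} {τ a b : ℝ} (hτ : 0 < τ)
    (hf : ContDiffOn ℝ 1 f (Icc 0 τ)) (hg : ContinuousOn g (Icc a b))
    (ha : 0 ≤ a) (hab : a ≤ b) (hb : b ≤ τ)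
    (hle : ∀ s ∈ Icc a b, derivWithin f (Icc 0 τ) s ≤ g s) :
    f b - f a ≤ ∫ s in a..b, g s := by
  have hsubI : Icc a b ⊆ Icc 0 τ := Icc_subset_Icc ha hb
  have hsub : uIcc a b ⊆ Icc 0 τ := by rwa [uIcc_of_le hab]
  have hcont : ContinuousOn f (Icc a b) := hf.continuousOn.mono hsubI
  have hf'cont : ContinuousOn (derivWithin f (Icc 0 τ)) (Icc 0 τ) :=
    hf.continuousOn_derivWithin (uniqueDiffOn_Icc hτ) le_rfl
  have hderiv : ∀ x ∈ Ioo a b, HasDerivAt f (derivWithin f (Icc 0 τ) x) x := by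
    intro x hx
    have hx0 : 0 < x := lt_of_le_of_lt ha hx.1
    have hxτ : x < τ := lt_of_lt_of_le hx.2 hb
    have hxI : Icc 0 τ ∈ nhds x := Icc_mem_nhds hx0 hxτ
    have hd : DifferentiableWithinAt ℝ f (Icc 0 τ) x :=
      (hf.differentiableOn one_ne_zero) x ⟨hx0.le, hxτ.le⟩
    rw [derivWithin_of_mem_nhds hxI]
    exact (hd.differentiableAt hxI).hasDerivAt
  have hint' : IntervalIntegrable (derivWithin f (Icc 0 τ)) volume a b :=
    (hf'cont.mono hsub).intervalIntegrable
  have hint : IntervalIntegrable g volume a b := (hg.mono (by rw [uIcc_of_le hab])).intervalIntegrable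
  have hftc := intervalIntegral.integral_eq_sub_of_hasDerivAt_of_le hab hcont hderiv hint'
  have hmono := intervalIntegral.integral_mono_on hab hint' hint fun u hu => hle u hu
  rw [hftc] at hmono
  exact hmono

/-- Lower-bound version: if `g ≤ derivWithin f (Icc 0 τ)` on `[a, b]` then `∫_a^b g ≤ f b − f a`. [folklore] -/
theorem integral_le_increment_of_le_derivWithin {f g : ℝ → ℝ} {τ a b : ℝ} (hτ : 0 < τ)
    (hf : ContDiffOn ℝ 1 f (Icc 0 τ)) (hg : ContinuousOn g (Icc a b))
    (ha : 0 ≤ a) (hab : a ≤ b) (hb : b ≤ τ)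
    (hle : ∀ s ∈ Icc a b, g s ≤ derivWithin f (Icc 0 τ) s) :
    (∫ s in a..b, g s) ≤ f b - f a := by
  have hsubI : Icc a b ⊆ Icc 0 τ := Icc_subset_Icc ha hb
  have hsub : uIcc a b ⊆ Icc 0 τ := by rwa [uIcc_of_le hab]
  have hcont : ContinuousOn f (Icc a b) := hf.continuousOn.mono hsubI
  have hf'cont : ContinuousOn (derivWithin f (Icc 0 τ)) (Icc 0 τ) :=
    hf.continuousOn_derivWithin (uniqueDiffOn_Icc hτ) le_rfl
  have hderiv : ∀ x ∈ Ioo a b, HasDerivAt f (derivWithin f (Icc 0 τ) x) x := by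
    intro x hx
    have hx0 : 0 < x := lt_of_le_of_lt ha hx.1
    have hxτ : x < τ := lt_of_lt_of_le hx.2 hb
    have hxI : Icc 0 τ ∈ nhds x := Icc_mem_nhds hx0 hxτ
    have hd : DifferentiableWithinAt ℝ f (Icc 0 τ) x :=
      (hf.differentiableOn one_ne_zero) x ⟨hx0.le, hxτ.le⟩
    rw [derivWithin_of_mem_nhds hxI]
    exact (hd.differentiableAt hxI).hasDerivAt
  have hint' : IntervalIntegrable (derivWithin f (Icc 0 τ)) volume a b :=
    (hf'cont.mono hsub).intervalIntegrable
  have hint : IntervalIntegrable g volume a b := (hg.mono (by rw [uIcc_of_le hab])).intervalIntegrable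
  have hftc := intervalIntegral.integral_eq_sub_of_hasDerivAt_of_le hab hcont hderiv hint'
  have hmono := intervalIntegral.integral_mono_on hab hint hint' fun u hu => hle u hu
  rw [hftc] at hmono
  exact hmono

/-! ### The clock: `u₁′ ≥ Λ m′ u₁` turns `∫ Λ u₁²` into increments of `u₁²` -/

/-- **Clock integral.** On `[a, b] ⊆ [0, τ]`, if `u` is `C¹` on `[0,τ]`, positive on `[a,b]`, and
`derivWithin u (Icc 0 τ) ≥ Λ·m′·u` there (`Λ, m′ > 0`), then `∫_a^b Λ·u² ≤ (u(b)² − u(a)²)/(2m′)`. [folklore] -/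
theorem clock_integral_le {u : ℝ → ℝ} {τ a b Λ m' : ℝ} (hτ : 0 < τ) (hu : ContDiffOn ℝ 1 u (Icc 0 τ))
    (ha : 0 ≤ a) (hab : a ≤ b) (hb : b ≤ τ) (hm : 0 < m')
    (hpos : ∀ s ∈ Icc a b, 0 ≤ u s)
    (hgrow : ∀ s ∈ Icc a b, Λ * m' * u s ≤ derivWithin u (Icc 0 τ) s) :
    (∫ s in a..b, Λ * u s ^ 2) ≤ (u b ^ 2 - u a ^ 2) / (2 * m') := by
  -- apply the lower-bound FTC to f = u·u / (2 m'), g = Λ u²: g ≤ f' = u u'/m' since u' ≥ Λ m' u and u ≥ 0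
  have hsubI : Icc a b ⊆ Icc 0 τ := Icc_subset_Icc ha hb
  have hf : ContDiffOn ℝ 1 (fun x => u x * u x / (2 * m')) (Icc 0 τ) := (hu.mul hu).div_const _
  have hg : ContinuousOn (fun s => Λ * u s ^ 2) (Icc a b) :=
    continuousOn_const.mul ((hu.continuousOn.mono hsubI).pow 2)
  have key : ∀ s ∈ Icc a b, Λ * u s ^ 2 ≤ derivWithin (fun x => u x * u x / (2 * m')) (Icc 0 τ) s := by
    intro s hs
    have hsI : s ∈ Icc 0 τ := hsubI hs
    have hud : DifferentiableWithinAt ℝ u (Icc 0 τ) s := (hu.differentiableOn one_ne_zero) s hsI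
    have huniq : UniqueDiffWithinAt ℝ (Icc 0 τ) s := uniqueDiffOn_Icc hτ s hsI
    have hder : HasDerivWithinAt (fun x => u x * u x / (2 * m'))
        ((derivWithin u (Icc 0 τ) s * u s + u s * derivWithin u (Icc 0 τ) s) / (2 * m')) (Icc 0 τ) s :=
      (hud.hasDerivWithinAt.mul hud.hasDerivWithinAt).div_const (2 * m')
    rw [hder.derivWithin huniq]
    have h1 := hgrow s hs
    have h2 := hpos s hs
    rw [le_div_iff₀ (by positivity)]
    -- Λ u² (2m') ≤ u'u + u u'  ⇐  u' ≥ Λ m' u, u ≥ 0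
    nlinarith [mul_le_mul_of_nonneg_left h1 h2]
  have h := integral_le_increment_of_le_derivWithin hτ hf hg ha hab hb key
  have e1 : u b * u b / (2 * m') - u a * u a / (2 * m') = (u b ^ 2 - u a ^ 2) / (2 * m') := by ring
  rw [e1] at h
  exact h

/-- **Clock growth.** On `[a, b] ⊆ [0, τ]`: if `u` is `C¹` on `[0,τ]`, `u(a) > 0` and `derivWithin u ≥ c·u` on `[a,b]`
(any real `c`), then `u(t) ≥ u(a)·exp(c (t − a))` on `[a, b]` (the trigger grows at least exponentially). [folklore] -/
theorem clock_exp_growth {u : ℝ → ℝ} {τ a b c : ℝ} (hu : ContDiffOn ℝ 1 u (Icc 0 τ))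
    (ha : 0 ≤ a) (hab : a ≤ b) (hb : b ≤ τ)
    (hgrow : ∀ s ∈ Icc a b, c * u s ≤ derivWithin u (Icc 0 τ) s) :
    ∀ t ∈ Icc a b, u a * Real.exp (c * (t - a)) ≤ u t := by
  -- g(t) := u(t)·exp(−c(t−a)) is monotone on [a,b] (derivative ≥ 0 in the interior)
  have hsubI : Icc a b ⊆ Icc 0 τ := Icc_subset_Icc ha hb
  set g : ℝ → ℝ := fun t => u t * Real.exp ((-c) * (t - a)) with hg
  have hE : ∀ t, HasDerivAt (fun t => Real.exp ((-c) * (t - a))) (Real.exp ((-c) * (t - a)) * (-c)) t := by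
    intro t
    have h1 : HasDerivAt (fun t => (-c) * (t - a)) (-c) t := by
      simpa using ((hasDerivAt_id t).sub_const a).const_mul (-c)
    exact (Real.hasDerivAt_exp _).comp t h1
  have hgc : ContinuousOn g (Icc a b) :=
    (hu.continuousOn.mono hsubI).mul (fun t _ => (hE t).continuousAt.continuousWithinAt)
  have hgd : DifferentiableOn ℝ g (interior (Icc a b)) := by
    rw [interior_Icc]; intro t ht
    have htI : Icc 0 τ ∈ nhds t := Icc_mem_nhds (lt_of_le_of_lt ha ht.1) (lt_of_lt_of_le ht.2 hb)
    have hud : DifferentiableAt ℝ u t := ((hu.differentiableOn one_ne_zero) t (hsubI ⟨ht.1.le, ht.2.le⟩)).differentiableAt htI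
    exact (hud.mul (hE t).differentiableAt).differentiableWithinAt
  have hg' : ∀ t ∈ interior (Icc a b), 0 ≤ deriv g t := by
    rw [interior_Icc]; intro t ht
    have htI : Icc 0 τ ∈ nhds t := Icc_mem_nhds (lt_of_le_of_lt ha ht.1) (lt_of_lt_of_le ht.2 hb)
    have hmem : t ∈ Icc 0 τ := hsubI ⟨ht.1.le, ht.2.le⟩
    have hud : DifferentiableWithinAt ℝ u (Icc 0 τ) t := (hu.differentiableOn one_ne_zero) t hmem
    have huda : HasDerivAt u (derivWithin u (Icc 0 τ) t) t := by
      rw [derivWithin_of_mem_nhds htI]; exact (hud.differentiableAt htI).hasDerivAt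
    have hder : HasDerivAt g (derivWithin u (Icc 0 τ) t * Real.exp ((-c) * (t - a)) +
        u t * (Real.exp ((-c) * (t - a)) * (-c))) t := huda.mul (hE t)
    rw [hder.deriv]
    have hpos : 0 < Real.exp ((-c) * (t - a)) := Real.exp_pos _
    have := hgrow t ⟨ht.1.le, ht.2.le⟩
    nlinarith [mul_le_mul_of_nonneg_right this hpos.le]
  have hmono : MonotoneOn g (Icc a b) := monotoneOn_of_deriv_nonneg (convex_Icc a b) hgc hgd hg'
  intro t ht
  have h1 := hmono (left_mem_Icc.mpr hab) ht ht.1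
  simp only [hg, sub_self, mul_zero, Real.exp_zero, mul_one] at h1
  -- u a ≤ u t · exp(−c(t−a))  ⇒  u a · exp(c(t−a)) ≤ u t
  have hpos : 0 < Real.exp (c * (t - a)) := Real.exp_pos _
  have e : Real.exp ((-c) * (t - a)) * Real.exp (c * (t - a)) = 1 := by
    rw [← Real.exp_add]; simp
  calc u a * Real.exp (c * (t - a)) ≤ (u t * Real.exp ((-c) * (t - a))) * Real.exp (c * (t - a)) :=
        mul_le_mul_of_nonneg_right h1 hpos.le
    _ = u t := by rw [mul_assoc, e, mul_one]

/-- **Clock time.** Under the hypotheses of `clock_exp_growth` with `c > 0` and `u(a) > 0`: if `u(t) ≤ w` at some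
`t ∈ [a, b]`, then `t − a ≤ log(w/u(a))/c` — the trigger cannot stay below `w` longer than that. [folklore] -/
theorem clock_time_le {u : ℝ → ℝ} {τ a b c w : ℝ} (hu : ContDiffOn ℝ 1 u (Icc 0 τ))
    (ha : 0 ≤ a) (hab : a ≤ b) (hb : b ≤ τ) (hc : 0 < c) (hua : 0 < u a)
    (hgrow : ∀ s ∈ Icc a b, c * u s ≤ derivWithin u (Icc 0 τ) s)
    {t : ℝ} (ht : t ∈ Icc a b) (hw : u t ≤ w) :
    t - a ≤ Real.log (w / u a) / c := by
  have h := clock_exp_growth hu ha hab hb hgrow t ht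
  have hw' : u a * Real.exp (c * (t - a)) ≤ w := h.trans hw
  have hwpos : 0 < w := lt_of_lt_of_le (by positivity) hw'
  rw [le_div_iff₀ hc, ← Real.log_exp (((t - a) * c)), mul_comm]
  apply Real.log_le_log (Real.exp_pos _)
  rw [le_div_iff₀ hua, mul_comm]
  exact hw'

/-- **The within-piece bootstrap for the next carrier `x₂`** (blueprint §3, recurrence for `X₂`). On a piece
`[a, b] ⊆ [0, τ]` on which the trigger satisfies `0 < w_a ≤ u ≤ w_b`, suppose `x₂(a) ≤ X_a`, `x₁ + x₂ ≥ s₀` on the piece,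
`x₂′ ≤ Λ u² + ε`, `u′ ≥ Λ (x₁ − x₂) u − ε₁`, and the numeric conditions `m′ ≤ s₀ − 2θX_b`,
`ε₁ ≤ Λ (s₀ − 2θX_b − m′) w_a`, `X_a + (w_b² − w_a²)/(2m′) + ε (b − a) ≤ X_b` (`θ > 1`, `m′ > 0`, `X_b > 0`). Then
`x₂ ≤ X_b` on the whole piece. (Proof: one-member one-sided slack bootstrap + `clock_integral_le`.) [folklore] -/
theorem clock_piece_x2 {u x₁ x₂ : ℝ → ℝ} {τ a b Λ ε ε₁ s₀ Xa Xb m' wa wb θ : ℝ} (hτ : 0 < τ)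
    (hu : ContDiffOn ℝ 1 u (Icc 0 τ)) (hx₂ : ContDiffOn ℝ 1 x₂ (Icc 0 τ))
    (ha : 0 ≤ a) (hab : a ≤ b) (hb : b ≤ τ) (hΛ : 0 ≤ Λ) (hm : 0 < m') (hθ : 1 < θ) (hXb : 0 < Xb) (hε : 0 ≤ ε)
    (hwa : 0 < wa) (hulo : ∀ s ∈ Icc a b, wa ≤ u s) (huhi : ∀ s ∈ Icc a b, u s ≤ wb)
    (hs₀ : ∀ s ∈ Icc a b, s₀ ≤ x₁ s + x₂ s) (hx₂a : x₂ a ≤ Xa)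
    (hx₂' : ∀ s ∈ Icc a b, derivWithin x₂ (Icc 0 τ) s ≤ Λ * u s ^ 2 + ε)
    (hu' : ∀ s ∈ Icc a b, Λ * (x₁ s - x₂ s) * u s - ε₁ ≤ derivWithin u (Icc 0 τ) s)
    (hm' : m' ≤ s₀ - 2 * (θ * Xb)) (hε₁ : ε₁ ≤ Λ * (s₀ - 2 * (θ * Xb) - m') * wa)
    (hroom : Xa + (wb ^ 2 - wa ^ 2) / (2 * m') + ε * (b - a) ≤ Xb) :
    ∀ t ∈ Icc a b, x₂ t ≤ Xb := by
  have hsubI : Icc a b ⊆ Icc 0 τ := Icc_subset_Icc ha hb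
  -- uniform one-sided growth of x₂ on the piece: x₂(t) − x₂(s) ≤ (Λ wb² + ε)(t − s)
  have hwb : 0 ≤ wb := (hwa.le.trans (hulo a (left_mem_Icc.mpr hab))).trans (huhi a (left_mem_Icc.mpr hab))
  have hgrowth : ∀ s ∈ Icc a b, ∀ t ∈ Icc a b, s ≤ t → x₂ t - x₂ s ≤ (Λ * wb ^ 2 + ε) * (t - s) := by
    intro s hs t ht hst
    have hcont : ContinuousOn (fun _ : ℝ => Λ * wb ^ 2 + ε) (Icc s t) := continuousOn_const
    have h := increment_le_integral_of_derivWithin_le hτ hx₂ hcont (ha.trans hs.1) hst (ht.2.trans hb)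
      (fun r hr => by
        have hrI : r ∈ Icc a b := ⟨hs.1.trans hr.1, hr.2.trans ht.2⟩
        have h1 := hx₂' r hrI
        have h2 : u r ^ 2 ≤ wb ^ 2 := pow_le_pow_left₀ (hwa.le.trans (hulo r hrI)) (huhi r hrI) 2
        nlinarith [mul_le_mul_of_nonneg_left h2 hΛ])
    rwa [intervalIntegral.integral_const, smul_eq_mul, mul_comm] at h
  -- the one-member slack bootstrap on the shifted time t' = t − a
  have key := Summit.NavierStokesRegularity.NavierStokesRegularity.Theorems.RelayFrontStep.bootstrap_family_oneSided_slack
    (ι := Unit) (u := fun _ t' => x₂ (a + t')) (p := fun _ => (1 : ℝ)) (ψ := fun _ => Xb) (τ := b - a)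
    (L := Λ * wb ^ 2 + ε) (θ := θ) hθ (fun _ => zero_le_one) (by positivity) continuousOn_const
    (fun _ _ => hXb)
    (fun _ s hs t ht hst => by
      have hs' : a + s ∈ Icc a b := ⟨by linarith [hs.1], by linarith [hs.2]⟩
      have ht' : a + t ∈ Icc a b := ⟨by linarith [ht.1], by linarith [ht.2]⟩
      have := hgrowth (a + s) hs' (a + t) ht' (by linarith)
      simpa [mul_one] using this)
    (fun _ => by simpa using hx₂a.trans (by
        have : 0 ≤ (wb ^ 2 - wa ^ 2) / (2 * m') := by
          apply div_nonneg _ (by positivity)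
          nlinarith [pow_le_pow_left₀ hwa.le ((hulo a (left_mem_Icc.mpr hab)).trans (huhi a (left_mem_Icc.mpr hab))) 2]
        nlinarith [mul_nonneg hε (sub_nonneg.mpr hab)]))
    (fun t' ht' hweak _ => by
      -- improvement step at x = a + t': x₂ ≤ θ Xb on [a, x] ⇒ x₁ − x₂ ≥ s₀ − 2θXb ⇒ u′ ≥ Λ m′ u ⇒ clock integral
      show x₂ (a + t') ≤ Xb * 1
      rw [mul_one]
      set x := a + t' with hxdef
      have hax : a ≤ x := by rw [hxdef]; linarith [ht'.1]
      have hxb : x ≤ b := by rw [hxdef]; linarith [ht'.2]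
      have hweak' : ∀ r ∈ Icc a x, x₂ r ≤ θ * Xb := by
        intro r hr
        have := hweak () (r - a) ⟨by linarith [hr.1], by linarith [hr.2]⟩
        simpa using this
      have hgrowu : ∀ r ∈ Icc a x, Λ * m' * u r ≤ derivWithin u (Icc 0 τ) r := by
        intro r hr
        have hrI : r ∈ Icc a b := ⟨hr.1, hr.2.trans hxb⟩
        have h1 := hu' r hrI
        have h2 := hs₀ r hrI
        have h3 := hweak' r hr
        have h4 := hulo r hrI
        -- Λ (x₁ − x₂) u − ε₁ ≥ Λ m' u
        have h5 : s₀ - 2 * (θ * Xb) ≤ x₁ r - x₂ r := by linarith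
        have h6 : Λ * (s₀ - 2 * (θ * Xb) - m') * wa ≤ Λ * (x₁ r - x₂ r - m') * u r := by
          have hA : 0 ≤ Λ * (s₀ - 2 * (θ * Xb) - m') := mul_nonneg hΛ (by linarith)
          calc Λ * (s₀ - 2 * (θ * Xb) - m') * wa ≤ Λ * (s₀ - 2 * (θ * Xb) - m') * u r :=
                mul_le_mul_of_nonneg_left h4 hA
            _ ≤ Λ * (x₁ r - x₂ r - m') * u r := by
                apply mul_le_mul_of_nonneg_right _ (hwa.le.trans h4)
                exact mul_le_mul_of_nonneg_left (by linarith) hΛ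
        nlinarith
      have hint := clock_integral_le hτ hu ha hax (hxb.trans hb) hm
        (fun r hr => hwa.le.trans (hulo r ⟨hr.1, hr.2.trans hxb⟩)) hgrowu
      -- x₂(x) − x₂(a) ≤ ∫ (Λ u² + ε)
      have hcont : ContinuousOn (fun r => Λ * u r ^ 2 + ε) (Icc a x) :=
        (continuousOn_const.mul ((hu.continuousOn.mono (Icc_subset_Icc ha (hxb.trans hb))).pow 2)).add continuousOn_const
      have hinc := increment_le_integral_of_derivWithin_le hτ hx₂ hcont ha hax (hxb.trans hb)
        (fun r hr => hx₂' r ⟨hr.1, hr.2.trans hxb⟩)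
      have hsplit : (∫ r in a..x, Λ * u r ^ 2 + ε) = (∫ r in a..x, Λ * u r ^ 2) + ε * (x - a) := by
        have hi1 : IntervalIntegrable (fun r => Λ * u r ^ 2) volume a x :=
          ((continuousOn_const.mul ((hu.continuousOn.mono (Icc_subset_Icc ha (hxb.trans hb))).pow 2)).mono
            (by rw [uIcc_of_le hax])).intervalIntegrable
        rw [intervalIntegral.integral_add hi1 (by simp), intervalIntegral.integral_const, smul_eq_mul, mul_comm (x - a)]
      rw [hsplit] at hinc
      -- (u x² − u a²)/(2m') ≤ (wb² − wa²)/(2m')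
      have hux : u x ^ 2 ≤ wb ^ 2 := pow_le_pow_left₀ (hwa.le.trans (hulo x ⟨hax, hxb⟩)) (huhi x ⟨hax, hxb⟩) 2
      have hua : wa ^ 2 ≤ u a ^ 2 := pow_le_pow_left₀ hwa.le (hulo a (left_mem_Icc.mpr hab)) 2
      have hq : (u x ^ 2 - u a ^ 2) / (2 * m') ≤ (wb ^ 2 - wa ^ 2) / (2 * m') :=
        div_le_div_of_nonneg_right (by linarith) (by positivity)
      have hεt : ε * (x - a) ≤ ε * (b - a) := mul_le_mul_of_nonneg_left (by linarith) hε
      linarith)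
  intro t ht
  have := key () (t - a) ⟨by linarith [ht.1], by linarith [ht.2]⟩
  simpa using this

end Summit.NavierStokesRegularity.NavierStokesRegularity.Cruxes.RelayFrontStep.Window2
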